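import Summits.CriticalPhenomena.CardyFormulaZ2.Theorems.CardyBoundaryCoulombGasHalfPlaneMarkDensityLawSymmDiffInclusion
import Summits.CriticalPhenomena.CardyFormulaZ2.Theorems.CardyBoundaryCoulombGasHalfPlaneMarkDensityLawShiftLipschitz
import Summits.CriticalPhenomena.CardyFormulaZ2.Theorems.CardyBoundaryCoulombGasHalfPlaneMarkDensityLawIsolationIndep
import Summits.CriticalPhenomena.CardyFormulaZ2.Theorems.CardyBoundaryCoulombGasHalfPlaneMarkDensityLawTwoArmPoint

/-!
# `HalfPlaneMarkDensityLaw` (crux stmt-CriticalPhenomena-5661), line `Sketch`: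
# the NEAR-END first-hit event — four-case inclusion and the uniform `n⁻²`-Lipschitz bound (lead c4-0)

The crux's event `firstHit halfPlane A_n ⌊cn⌋ k` ("`k` is the `c`-most vertex of `[⌊cn⌋,∞)` joined to the
source arc `A_n`, which lies to the LEFT, beyond the excluded arc") is the lattice derivative of the CDF
`P_n(a,b,c,y) = P[A_n ↔ [⌊cn⌋,⌊yn⌋]]` in its FAR end `y`.  Its derivative in the NEAR (gap-side) end `b`
of the source arc is a first-hit event of the other geometry:
`firstHit halfPlane (rowIcc ⌊cn⌋ ⌊yn⌋) ⌊an⌋ k`, `⌊an⌋ ≤ … < k < ⌊cn⌋` — the source arc lies to the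
RIGHT of the point and the excluded arc `[⌊an⌋, k)` to its left, AWAY from the source (the two arms at
`(k,0)` point in opposite directions, Werner's "good point" with macroscopic targets).  For this event:

* `NearEnd.mem_iso_of_mem_symmDiff` — the four-case inclusion: moving the source arc `[γ,δ]` and the
  start `α` of the excluded arc one site to the left changes the event at `k` only on configurations
  with a left-isolated arm at `k` AND an isolated arm at a moved mark end
  (`symmDiff ⊆ liso k ∩ (liso δ ∪ riso (α−1) ∪ riso (γ−1))`, radius `R`);
* `NearEnd.abs_sub_succ_le` — hence (translation, independence in disjoint half-boxes, the two-arm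
  point bound `stub_twoArmPoint`) `|P[E(k+1)] − P[E(k)]| ≤ 3 C_A²/R²`;
* `NearEnd.uniformLipschitz` — the `n⁻²`-Lipschitz bound of the near-end density with a constant that
  is UNIFORM over `4ε`-separated marks: for `4ε ≤ x₀ − a`, `4ε ≤ c − x₁`, `4ε ≤ y − c`,
  `|g n k' − g n k| ≤ C (k'−k)/n²` on `⌊x₀n⌋ ≤ k ≤ k' ≤ ⌊x₁n⌋`, `g n k = P[firstHit halfPlane C_n ⌊an⌋ k]`.

Companion file `…NearEndRegularity`: differentiability of the joint subsequential limits in the inner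
marks `b`, `c`.
-/

noncomputable section

namespace Summit.CriticalPhenomena.CardyFormulaZ2.Cruxes.HalfPlaneMarkDensityLaw.SketchLine

open Literature.Probability.Percolation Literature.Probability.LatticeModels
open MeasureTheory Filter Set
open Summit.CriticalPhenomena.CardyFormulaZ2.Theorems.HalfPlaneMarkDensityLaw.Negative

namespace NearEnd

open SymmDiff

/-! ### The four-case inclusion for the near-end event -/

/-- Case (0): on a near-end first-hit event whose source arc `[γ',δ']×{0}` lies right of the box
(`k + R < γ'`) and whose excluded window starts at `α' ≤ k − R`, `(k,0)` carries a left-isolated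
arm to distance `R`. [folklore] -/
theorem leftIso_of_firstHit_right {ω : BondConfig (Site 2)} (hω : ω ⊆ (zdGraph 2).edgeSet)
    {γ' δ' α' k : ℤ} {R : ℕ} (hγ : k + R < γ') (hα : α' + R ≤ k)
    (h : ω ∈ firstHit halfPlane (rowIcc γ' δ') α' k) : ω ∈ iso k R (rowIcc (k - R) (k - 1)) := by
  obtain ⟨⟨x, hx, y, hy, hxy⟩, hnot⟩ := h
  obtain rfl : y = bpt k := hy
  obtain ⟨hx1, hx0, hx0'⟩ := hx
  refine iso_of hω (w := x) ?_ (conn_symm hxy) ?_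
  · rintro ⟨-, -, -, h4⟩; omega
  · rintro v ⟨hv1, hv0, hv0'⟩ hv
    exact hnot ⟨x, ⟨hx1, hx0, hx0'⟩, v, ⟨hv1, by omega, by omega⟩,
      PlanarDuality.openConnIn_trans hxy (conn_symm hv)⟩

/-- **The four-case inclusion for the near-end event.** With source arc `[γ,δ]×{0}` to the right of
`k` and excluded arc `[α,k)×{0}` to its left (`R ≤ δ − γ + 1`, `2R + 2 ≤ γ − k`, `2R + 1 ≤ k − α`): on the
symmetric difference of the event and its left translate, `(k,0)` is left-isolated and one moved mark
end carries an isolated arm. [folklore] -/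
theorem mem_iso_of_mem_symmDiff {ω : BondConfig (Site 2)} (hω : ω ⊆ (zdGraph 2).edgeSet)
    {α k γ δ : ℤ} {R : ℕ} (h₁ : (R : ℤ) ≤ δ - γ + 1) (h₂ : 2 * (R : ℤ) + 2 ≤ γ - k)
    (h₃ : 2 * (R : ℤ) + 1 ≤ k - α)
    (hmem : ω ∈ symmDiff (firstHit halfPlane (rowIcc γ δ) α k)
      (firstHit halfPlane (rowIcc (γ - 1) (δ - 1)) (α - 1) k)) :
    ω ∈ iso k R (rowIcc (k - R) (k - 1)) ∩
      (iso δ R (rowIcc (δ - R) (δ - 1)) ∪ iso (α - 1) R (rowIcc ((α - 1) + 1) ((α - 1) + R)) ∪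
        iso (γ - 1) R (rowIcc ((γ - 1) + 1) ((γ - 1) + R))) := by
  rcases Set.mem_symmDiff.1 hmem with ⟨hE, hE'⟩ | ⟨hE', hE⟩
  · -- (1) `ω ∈ E \ E'`
    refine ⟨leftIso_of_firstHit_right hω (by omega) (by omega) hE, ?_⟩
    obtain ⟨⟨x, hx, y, hy, hxy⟩, hnX⟩ := hE
    obtain rfl : y = bpt k := hy
    by_cases hC' : ω ∈ openCrossing halfPlane (rowIcc (γ - 1) (δ - 1)) {bpt k}
    · -- (1b) some vertex of `[α−1,k)×{0}` is joined to the moved source arc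
      have hX' : ω ∈ openCrossing halfPlane (rowIcc (γ - 1) (δ - 1)) (rowIco (α - 1) k) := by
        by_contra hX'; exact hE' ⟨hC', hX'⟩
      obtain ⟨x', hx', y', hy', hx'y'⟩ := hX'
      obtain ⟨hy'1, hy'0, hy'0'⟩ := hy'
      obtain ⟨hx'1, hx'0, hx'0'⟩ := hx'
      by_cases hz : ∃ z ∈ rowIcc γ δ, ω ∈ openConnIn halfPlane z y'
      · -- `y' = (α−1, 0)` is joined to the old source arc: right-isolated arm at `α − 1`
        obtain ⟨z, hz, hzy'⟩ := hz
        obtain ⟨hz1, hz0, hz0'⟩ := hz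
        have hy'eq : y' = bpt (α - 1) := by
          rw [site_eq_bpt_iff]
          refine ⟨hy'1, ?_⟩
          by_contra hne
          exact hnX ⟨z, ⟨hz1, hz0, hz0'⟩, y', ⟨hy'1, by omega, hy'0'⟩, hzy'⟩
        subst hy'eq
        refine Or.inl (Or.inr (iso_of hω (w := z) ?_ (conn_symm hzy') ?_))
        · rintro ⟨-, -, -, h4⟩; omega
        · rintro v ⟨hv1, hv0, hv0'⟩ hv
          exact hnX ⟨z, ⟨hz1, hz0, hz0'⟩, v, ⟨hv1, by omega, by omega⟩,
            PlanarDuality.openConnIn_trans hzy' (conn_symm hv)⟩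
      · -- otherwise `x' = (γ−1, 0)`: right-isolated arm at `γ − 1`
        push Not at hz
        have hx'eq : x' = bpt (γ - 1) := by
          rw [site_eq_bpt_iff]
          refine ⟨hx'1, ?_⟩
          by_contra hne
          exact hz x' ⟨hx'1, by omega, by omega⟩ hx'y'
        subst hx'eq
        refine Or.inr (iso_of hω (w := y') ?_ hx'y' ?_)
        · rintro ⟨-, -, h3, -⟩; omega
        · rintro v ⟨hv1, hv0, hv0'⟩ hv
          exact hz v ⟨hv1, by omega, by omega⟩ (PlanarDuality.openConnIn_trans hv hx'y')
    · -- (1a) `(k,0)` is joined to the old source arc only through `(δ,0)`: left-isolated arm at `δ`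
      obtain ⟨hx1, hx0, hx0'⟩ := hx
      have hxeq : x = bpt δ := by
        rw [site_eq_bpt_iff]
        refine ⟨hx1, ?_⟩
        by_contra hne
        exact hC' ⟨x, ⟨hx1, by omega, by omega⟩, bpt k, rfl, hxy⟩
      subst hxeq
      refine Or.inl (Or.inl (iso_of hω (w := bpt k) ?_ hxy ?_))
      · rintro ⟨-, -, h3, -⟩; simp only [bpt_apply_zero] at h3; omega
      · rintro v ⟨hv1, hv0, hv0'⟩ hv
        exact hC' ⟨v, ⟨hv1, by omega, by omega⟩, bpt k, rfl, PlanarDuality.openConnIn_trans hv hxy⟩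
  · -- (2) `ω ∈ E' \ E`
    refine ⟨leftIso_of_firstHit_right hω (by omega) (by omega) hE', ?_⟩
    obtain ⟨⟨x, hx, y, hy, hxy⟩, hnX'⟩ := hE'
    obtain rfl : y = bpt k := hy
    by_cases hC : ω ∈ openCrossing halfPlane (rowIcc γ δ) {bpt k}
    · -- (2b) some vertex of `[α,k)×{0}` is joined to the old source arc, necessarily to `(δ,0)`:
      -- left-isolated arm at `δ`
      have hX : ω ∈ openCrossing halfPlane (rowIcc γ δ) (rowIco α k) := by
        by_contra hX; exact hE ⟨hC, hX⟩
      obtain ⟨x', hx', y', hy', hx'y'⟩ := hX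
      obtain ⟨hy'1, hy'0, hy'0'⟩ := hy'
      obtain ⟨hx'1, hx'0, hx'0'⟩ := hx'
      have hx'eq : x' = bpt δ := by
        rw [site_eq_bpt_iff]
        refine ⟨hx'1, ?_⟩
        by_contra hne
        exact hnX' ⟨x', ⟨hx'1, by omega, by omega⟩, y', ⟨hy'1, by omega, hy'0'⟩, hx'y'⟩
      subst hx'eq
      refine Or.inl (Or.inl (iso_of hω (w := y') ?_ hx'y' ?_))
      · rintro ⟨-, -, h3, -⟩; omega
      · rintro v ⟨hv1, hv0, hv0'⟩ hv
        exact hnX' ⟨v, ⟨hv1, by omega, by omega⟩, y', ⟨hy'1, by omega, hy'0'⟩,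
          PlanarDuality.openConnIn_trans hv hx'y'⟩
    · -- (2a) `(k,0)` is joined to the moved source arc only through `(γ−1,0)`: right-isolated arm
      -- at `γ − 1`
      obtain ⟨hx1, hx0, hx0'⟩ := hx
      have hxeq : x = bpt (γ - 1) := by
        rw [site_eq_bpt_iff]
        refine ⟨hx1, ?_⟩
        by_contra hne
        exact hC ⟨x, ⟨hx1, by omega, by omega⟩, bpt k, rfl, hxy⟩
      subst hxeq
      refine Or.inr (iso_of hω (w := bpt k) ?_ hxy ?_)
      · rintro ⟨-, -, h3, -⟩; simp only [bpt_apply_zero] at h3; omega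
      · rintro v ⟨hv1, hv0, hv0'⟩ hv
        exact hC ⟨v, ⟨hv1, by omega, by omega⟩, bpt k, rfl, PlanarDuality.openConnIn_trans hv hxy⟩

/-! ### One Lipschitz step for the near-end density -/

/-- Independence of a left-isolated arm at `k` and an isolated arm at `k'` to the RIGHT of `k`
(`2R < k' − k`): product structure of `P_{1/2}` over vertex-disjoint half-boxes. [folklore] -/
theorem real_liso_inter_le {k k' : ℤ} {R : ℕ} (h : 2 * (R : ℤ) < k' - k) (B : Set (Site 2)) :
    μ.real (Shift.liso k R ∩ (openCrossing (Shift.hb k' R) {bpt k'} (Shift.hrim k' R) \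
        openCrossing (Shift.hb k' R) B {bpt k'})) ≤
      μ.real (Shift.liso k R) *
        μ.real (openCrossing (Shift.hb k' R) {bpt k'} (Shift.hrim k' R) \
          openCrossing (Shift.hb k' R) B {bpt k'}) :=
  (Indep.real_inter_diff_openCrossing (Indep.halfBox_finite k R) (Indep.halfBox_finite k' R)
    (Indep.disjoint_halfBox h).symm _ _ _ _ _ _ _ _).le

/-- **One Lipschitz step for the near-end event**: with `C_A` the two-arm point constant
(`stub_twoArmPoint`), for `1 ≤ R`, `R ≤ δ − γ + 1`, `2R + 2 ≤ γ − k`, `2R + 1 ≤ k − α`: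
`|P[firstHit halfPlane [γ,δ] α (k+1)] − P[firstHit halfPlane [γ,δ] α k]| ≤ 3 C_A²/R²`. [folklore] -/
theorem abs_sub_succ_le {C_A : ℝ} (hC : 0 ≤ C_A)
    (hA : ∀ (k : ℤ) (R : ℕ), 1 ≤ R →
      μ.real (Shift.liso k R) ≤ C_A / R ∧ μ.real (Shift.riso k R) ≤ C_A / R)
    (α k γ δ : ℤ) (R : ℕ) (hR : 1 ≤ R) (h₁ : (R : ℤ) ≤ δ - γ + 1) (h₂ : 2 * (R : ℤ) + 2 ≤ γ - k)
    (h₃ : 2 * (R : ℤ) + 1 ≤ k - α) :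
    |μ.real (firstHit halfPlane (rowIcc γ δ) α (k + 1)) -
        μ.real (firstHit halfPlane (rowIcc γ δ) α k)| ≤ 3 * C_A ^ 2 / (R : ℝ) ^ 2 := by
  -- Step 1: exact translation.
  have hshift : μ.real (firstHit halfPlane (rowIcc γ δ) α (k + 1)) =
      μ.real (firstHit halfPlane (rowIcc (γ - 1) (δ - 1)) (α - 1) k) := by
    have h := measureReal_firstHit_shift (rowIcc (γ - 1) (δ - 1)) (k₀ := α - 1) (k := k) (by omega)
    simpa only [image_shift_rowIcc, sub_add_cancel] using h
  -- Step 2: `|P E' − P E| ≤ P (E ∆ E')`.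
  have hsd : |μ.real (firstHit halfPlane (rowIcc (γ - 1) (δ - 1)) (α - 1) k) -
      μ.real (firstHit halfPlane (rowIcc γ δ) α k)| ≤
      μ.real (symmDiff (firstHit halfPlane (rowIcc γ δ) α k)
        (firstHit halfPlane (rowIcc (γ - 1) (δ - 1)) (α - 1) k)) := by
    rw [abs_sub_comm]
    exact abs_measureReal_sub_le_measureReal_symmDiff
      (measurableSet_firstHit _ _ _ _).nullMeasurableSet
      (measurableSet_firstHit _ _ _ _).nullMeasurableSet
  -- Step 3: the four-case inclusion, almost surely.
  have hincl : μ.real (symmDiff (firstHit halfPlane (rowIcc γ δ) α k)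
        (firstHit halfPlane (rowIcc (γ - 1) (δ - 1)) (α - 1) k)) ≤
      μ.real (Shift.liso k R ∩ (Shift.liso δ R ∪ Shift.riso (α - 1) R ∪ Shift.riso (γ - 1) R)) := by
    rw [measureReal_def, measureReal_def]
    refine ENNReal.toReal_mono (measure_ne_top _ _) (measure_mono_ae ?_)
    filter_upwards [ae_subset_edgeSet (zdGraph 2) half] with ω hω hmem
    exact mem_iso_of_mem_symmDiff hω h₁ h₂ h₃ hmem
  -- Step 4: union bound.
  have hunion : μ.real (Shift.liso k R ∩ (Shift.liso δ R ∪ Shift.riso (α - 1) R ∪ Shift.riso (γ - 1) R)) ≤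
      μ.real (Shift.liso k R ∩ Shift.liso δ R) + μ.real (Shift.liso k R ∩ Shift.riso (α - 1) R) +
        μ.real (Shift.liso k R ∩ Shift.riso (γ - 1) R) := by
    rw [Set.inter_union_distrib_left, Set.inter_union_distrib_left]
    exact (measureReal_union_le _ _).trans (add_le_add (measureReal_union_le _ _) le_rfl)
  -- Step 5: independence and the point bound.
  have hCR : 0 ≤ C_A / R := div_nonneg hC (Nat.cast_nonneg R)
  obtain ⟨hLk, -⟩ := hA k R hR
  obtain ⟨hLδ, -⟩ := hA δ R hR
  obtain ⟨-, hRα⟩ := hA (α - 1) R hR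
  obtain ⟨-, hRγ⟩ := hA (γ - 1) R hR
  have hb₁ : μ.real (Shift.liso k R ∩ Shift.liso δ R) ≤ C_A / R * (C_A / R) :=
    (real_liso_inter_le (by omega) _).trans (mul_le_mul hLk hLδ measureReal_nonneg hCR)
  have hb₂ : μ.real (Shift.liso k R ∩ Shift.riso (α - 1) R) ≤ C_A / R * (C_A / R) :=
    (stub_isolationIndep k (α - 1) R (by omega)).2.trans (mul_le_mul hLk hRα measureReal_nonneg hCR)
  have hb₃ : μ.real (Shift.liso k R ∩ Shift.riso (γ - 1) R) ≤ C_A / R * (C_A / R) :=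
    (real_liso_inter_le (by omega) _).trans (mul_le_mul hLk hRγ measureReal_nonneg hCR)
  have hring : 3 * C_A ^ 2 / (R : ℝ) ^ 2 = 3 * (C_A / R * (C_A / R)) := by ring
  rw [hshift, hring]
  linarith

/-! ### The uniform `n⁻²`-Lipschitz bound for the near-end density -/

/-- **Uniform `n⁻²`-Lipschitz bound for the near-end density (registered extra stub
`stub_nearEndLipschitz` of line `Sketch`).** For every `ε > 0` there is `C ≥ 0` such that for ALL marks
with `4ε ≤ x₀ − a`, `4ε ≤ c − x₁`, `4ε ≤ y − c`, all `n ≥ 1` and all `⌊x₀n⌋ ≤ k ≤ k' ≤ ⌊x₁n⌋`: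
`|g n k' − g n k| ≤ C (k'−k)/n²`, `g n k = P[firstHit halfPlane [⌊cn⌋,⌊yn⌋] ⌊an⌋ k]`. [folklore] -/
theorem uniformLipschitz {ε : ℝ} (hε : 0 < ε) :
    ∃ C : ℝ, 0 ≤ C ∧ ∀ a c y x₀ x₁ : ℝ, 4 * ε ≤ x₀ - a → 4 * ε ≤ c - x₁ → 4 * ε ≤ y - c →
      ∀ n : ℕ, 1 ≤ n → ∀ k k' : ℤ, ⌊x₀ * n⌋ ≤ k → k ≤ k' → k' ≤ ⌊x₁ * n⌋ →
        |μ.real (firstHit halfPlane (rowIcc ⌊c * n⌋ ⌊y * n⌋) ⌊a * n⌋ k') -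
            μ.real (firstHit halfPlane (rowIcc ⌊c * n⌋ ⌊y * n⌋) ⌊a * n⌋ k)| ≤
          C * (k' - k) / (n : ℝ) ^ 2 := by
  obtain ⟨C_A, hA⟩ := stub_twoArmPoint
  have hC : 0 ≤ C_A := by
    have h := (hA 0 1 le_rfl).1
    rw [Nat.cast_one (R := ℝ), div_one] at h
    exact measureReal_nonneg.trans h
  obtain ⟨n₀, hn₀⟩ := exists_nat_ge (2 / ε)
  have hK₀ : 0 ≤ 12 * C_A ^ 2 / ε ^ 2 := by positivity
  refine ⟨12 * C_A ^ 2 / ε ^ 2 + (n₀ : ℝ) ^ 2, by positivity,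
    fun a c y x₀ x₁ hεxa hεcx hεyc n hn k k' hk hkk' hk' ↦ ?_⟩
  have hn' : (0 : ℝ) < n := Nat.cast_pos.2 hn
  obtain ⟨m, rfl⟩ : ∃ m : ℕ, k' = k + m := ⟨(k' - k).toNat, by omega⟩
  rcases lt_or_ge n n₀ with hlt | hge
  · -- small `n`: crude bound
    rcases Nat.eq_zero_or_pos m with rfl | hm
    · simp
    have hu₁ : μ.real (firstHit halfPlane (rowIcc ⌊c * n⌋ ⌊y * n⌋) ⌊a * n⌋ (k + m)) ≤ 1 :=
      measureReal_le_one
    have hu₂ : μ.real (firstHit halfPlane (rowIcc ⌊c * n⌋ ⌊y * n⌋) ⌊a * n⌋ k) ≤ 1 := measureReal_le_one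
    have hl₁ : 0 ≤ μ.real (firstHit halfPlane (rowIcc ⌊c * n⌋ ⌊y * n⌋) ⌊a * n⌋ (k + m)) :=
      measureReal_nonneg
    have hl₂ : 0 ≤ μ.real (firstHit halfPlane (rowIcc ⌊c * n⌋ ⌊y * n⌋) ⌊a * n⌋ k) := measureReal_nonneg
    have h1 : |μ.real (firstHit halfPlane (rowIcc ⌊c * n⌋ ⌊y * n⌋) ⌊a * n⌋ (k + m)) -
        μ.real (firstHit halfPlane (rowIcc ⌊c * n⌋ ⌊y * n⌋) ⌊a * n⌋ k)| ≤ 1 := by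
      rw [abs_sub_le_iff]; constructor <;> linarith
    refine h1.trans ?_
    rw [le_div_iff₀ (by positivity), one_mul]
    have hm1 : (1 : ℝ) ≤ m := by exact_mod_cast hm
    have hnn₀ : (n : ℝ) ^ 2 ≤ (n₀ : ℝ) ^ 2 := by
      have : (n : ℝ) ≤ n₀ := by exact_mod_cast hlt.le
      exact pow_le_pow_left₀ hn'.le this 2
    calc (n : ℝ) ^ 2 ≤ (n₀ : ℝ) ^ 2 := hnn₀
      _ ≤ 12 * C_A ^ 2 / ε ^ 2 + (n₀ : ℝ) ^ 2 := le_add_of_nonneg_left hK₀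
      _ ≤ (12 * C_A ^ 2 / ε ^ 2 + (n₀ : ℝ) ^ 2) * (m : ℝ) :=
        le_mul_of_one_le_right (by positivity) hm1
      _ = _ := by push_cast; ring
  · -- large `n`: radius `R = ⌊εn⌋₊`
    have hεn : 2 ≤ ε * n := by
      have h1 : (n₀ : ℝ) ≤ n := by exact_mod_cast hge
      have h2 := (div_le_iff₀ hε).1 (hn₀.trans h1)
      linarith
    set R : ℕ := ⌊ε * n⌋₊ with hR_def
    have hRle : (R : ℝ) ≤ ε * n := Nat.floor_le (by positivity)
    have hRlt : ε * n < R + 1 := Nat.lt_floor_add_one _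
    have hR1 : 1 ≤ R := by
      rw [hR_def, Nat.one_le_floor_iff]
      linarith
    have hR1' : (1 : ℝ) ≤ R := by exact_mod_cast hR1
    have hαle : (⌊a * n⌋ : ℝ) ≤ a * n := Int.floor_le _
    have hγlt : c * n < ⌊c * n⌋ + 1 := Int.lt_floor_add_one _
    have hγle : (⌊c * n⌋ : ℝ) ≤ c * n := Int.floor_le _
    have hδlt : y * n < ⌊y * n⌋ + 1 := Int.lt_floor_add_one _
    have hx₀lt : x₀ * n < ⌊x₀ * n⌋ + 1 := Int.lt_floor_add_one _
    have hx₁le : (⌊x₁ * n⌋ : ℝ) ≤ x₁ * n := Int.floor_le _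
    have hxa' : 4 * ε * n ≤ (x₀ - a) * n := mul_le_mul_of_nonneg_right hεxa hn'.le
    have hcx' : 4 * ε * n ≤ (c - x₁) * n := mul_le_mul_of_nonneg_right hεcx hn'.le
    have hyc' : 4 * ε * n ≤ (y - c) * n := mul_le_mul_of_nonneg_right hεyc hn'.le
    have h₁ : (R : ℤ) ≤ ⌊y * n⌋ - ⌊c * n⌋ + 1 := by
      have h : (R : ℝ) < ⌊y * n⌋ - ⌊c * n⌋ + 1 := by linarith
      have h' : (R : ℤ) < ⌊y * n⌋ - ⌊c * n⌋ + 1 := by exact_mod_cast h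
      omega
    have h₂ : ∀ j : ℤ, j < k + m → 2 * (R : ℤ) + 2 ≤ ⌊c * n⌋ - j := by
      intro j hj
      have h : 2 * (R : ℝ) + 2 < ⌊c * n⌋ - ⌊x₁ * n⌋ + 1 := by linarith
      have h' : 2 * (R : ℤ) + 2 < ⌊c * n⌋ - ⌊x₁ * n⌋ + 1 := by exact_mod_cast h
      omega
    have h₃ : ∀ j : ℤ, k ≤ j → 2 * (R : ℤ) + 1 ≤ j - ⌊a * n⌋ := by
      intro j hj
      have h : 2 * (R : ℝ) + 1 < ⌊x₀ * n⌋ - ⌊a * n⌋ := by linarith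
      have h' : 2 * (R : ℤ) + 1 < ⌊x₀ * n⌋ - ⌊a * n⌋ := by exact_mod_cast h
      omega
    -- one-step bounds on the window, telescoping
    have hstep : ∀ i : ℕ, i < m →
        |μ.real (firstHit halfPlane (rowIcc ⌊c * n⌋ ⌊y * n⌋) ⌊a * n⌋ (k + i + 1)) -
          μ.real (firstHit halfPlane (rowIcc ⌊c * n⌋ ⌊y * n⌋) ⌊a * n⌋ (k + i))| ≤
            3 * C_A ^ 2 / (R : ℝ) ^ 2 :=
      fun i hi ↦ abs_sub_succ_le hC hA ⌊a * n⌋ (k + i) ⌊c * n⌋ ⌊y * n⌋ R hR1 h₁ (h₂ (k + i) (by omega))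
        (h₃ (k + i) (by omega))
    have htel : ∀ m' : ℕ, m' ≤ m →
        |μ.real (firstHit halfPlane (rowIcc ⌊c * n⌋ ⌊y * n⌋) ⌊a * n⌋ (k + m')) -
          μ.real (firstHit halfPlane (rowIcc ⌊c * n⌋ ⌊y * n⌋) ⌊a * n⌋ k)| ≤
            m' * (3 * C_A ^ 2 / (R : ℝ) ^ 2) := by
      intro m' hm'
      induction m' with
      | zero => simp
      | succ m' ih =>
        have ih' := ih (by omega)
        have hs := hstep m' (by omega)
        rw [show k + ((m' + 1 : ℕ) : ℤ) = k + m' + 1 by push_cast; ring]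
        calc _ ≤ |μ.real (firstHit halfPlane (rowIcc ⌊c * n⌋ ⌊y * n⌋) ⌊a * n⌋ (k + m' + 1)) -
              μ.real (firstHit halfPlane (rowIcc ⌊c * n⌋ ⌊y * n⌋) ⌊a * n⌋ (k + m'))| +
            |μ.real (firstHit halfPlane (rowIcc ⌊c * n⌋ ⌊y * n⌋) ⌊a * n⌋ (k + m')) -
              μ.real (firstHit halfPlane (rowIcc ⌊c * n⌋ ⌊y * n⌋) ⌊a * n⌋ k)| := abs_sub_le _ _ _
          _ ≤ 3 * C_A ^ 2 / (R : ℝ) ^ 2 + m' * (3 * C_A ^ 2 / (R : ℝ) ^ 2) := add_le_add hs ih'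
          _ = ((m' + 1 : ℕ) : ℝ) * (3 * C_A ^ 2 / (R : ℝ) ^ 2) := by push_cast; ring
    have hD : 3 * C_A ^ 2 / (R : ℝ) ^ 2 ≤ (12 * C_A ^ 2 / ε ^ 2 + (n₀ : ℝ) ^ 2) / (n : ℝ) ^ 2 := by
      have hR2 : ε * n ≤ 2 * R := by linarith
      have hRpos : (0 : ℝ) < R := by linarith
      rw [div_le_div_iff₀ (by positivity) (by positivity)]
      have h4 : (ε * n) ^ 2 ≤ (2 * R) ^ 2 := pow_le_pow_left₀ (by positivity) hR2 2
      have hεne : ε ≠ 0 := hε.ne'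
      calc 3 * C_A ^ 2 * (n : ℝ) ^ 2 = 3 * C_A ^ 2 / ε ^ 2 * (ε * n) ^ 2 := by
            field_simp
        _ ≤ 3 * C_A ^ 2 / ε ^ 2 * (2 * R) ^ 2 := mul_le_mul_of_nonneg_left h4 (by positivity)
        _ = 12 * C_A ^ 2 / ε ^ 2 * (R : ℝ) ^ 2 := by ring
        _ ≤ (12 * C_A ^ 2 / ε ^ 2 + (n₀ : ℝ) ^ 2) * (R : ℝ) ^ 2 :=
          mul_le_mul_of_nonneg_right (le_add_of_nonneg_right (by positivity)) (by positivity)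
    calc _ ≤ (m : ℝ) * (3 * C_A ^ 2 / (R : ℝ) ^ 2) := htel m le_rfl
      _ ≤ (m : ℝ) * ((12 * C_A ^ 2 / ε ^ 2 + (n₀ : ℝ) ^ 2) / (n : ℝ) ^ 2) :=
        mul_le_mul_of_nonneg_left hD (Nat.cast_nonneg m)
      _ = _ := by push_cast; ring

/-- **Registered extra stub of line `Sketch` (lead c4-0): the uniform `n⁻²`-Lipschitz bound for the
near-end density**, closed form of `uniformLipschitz`. [folklore] -/
theorem stub_nearEndLipschitz :
    ∀ ε : ℝ, 0 < ε → ∃ C : ℝ, 0 ≤ C ∧ ∀ a c y x₀ x₁ : ℝ, 4 * ε ≤ x₀ - a → 4 * ε ≤ c - x₁ →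
      4 * ε ≤ y - c → ∀ n : ℕ, 1 ≤ n → ∀ k k' : ℤ, ⌊x₀ * n⌋ ≤ k → k ≤ k' → k' ≤ ⌊x₁ * n⌋ →
        |μ.real (firstHit halfPlane (rowIcc ⌊c * n⌋ ⌊y * n⌋) ⌊a * n⌋ k') -
            μ.real (firstHit halfPlane (rowIcc ⌊c * n⌋ ⌊y * n⌋) ⌊a * n⌋ k)| ≤
          C * (k' - k) / (n : ℝ) ^ 2 :=
  fun _ hε ↦ uniformLipschitz hε

end NearEnd

end Summit.CriticalPhenomena.CardyFormulaZ2.Cruxes.HalfPlaneMarkDensityLaw.SketchLine
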